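import Summits.Ventures.Crystal3D.Theorems.StickyWulffConstantGenericWallFloorEndBallExactPatternsB
import HarnessLib

/-!
# §51 — THE EXACT END-BALL PATTERNS: decide-grade per-pattern facts (well-formed, `1`-separated, every empty slot blocked, degree)
# (crux `GenericWallFloor`, stmt-Ventures-19480, line `WallLedgerG`; cf-p1 22:11:43Z «EndBallClass rows with combinatorial credit, decide-grade»)

HONEST FRAMING. Venture `Summits/Ventures/Crystal3D` (cell `crystal3d-full`), helper `--supports` the crux `GenericWallFloor` of
`route-Ventures-StickyWulffConstant`, REGISTERED line `WallLedgerG`, open stub `stub_twoSlabAdhesion`.  Kernel checks (`decide +kernel`) of the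
literal pattern lists of `…EndBallExactPatternsA/B`; standard axioms, census-free.  F-C1 not moved.

For each of the four lists, every pattern `C` satisfies: `C.wf` (contacts are distinct slots); all own balls have `|q|² ∈ {18, 36}` (twin contacts /
twin `√2`-blockers); the listed points are pairwise `1`-separated (`sdot3 (p − p′) (p − p′) ≥ 18`); EVERY one of the twelve slots is occupied or
blocked by an own ball within `√(1/3)` (`sdot3 (p − 3σ) (p − 3σ) < 18`, in fact `= 6`); and the DEGREE bookkeeping: `#contacts + #(own at |q|² = 18)`
is `8 / 9 / 10 / 10` with `#(own at |q|² = 18) = 0 / ≤ 1 / ≤ 1 / = 2` respectively (the last = the residual «defective twin caps»).  So the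
exact-branch credit `12 − deg` of a carrier whose `√3`-neighbourhood is on the menu is `4 / 3 / 2` (and `2` for the residual list, where however
the count hypothesis `deg ≤ k + 1` of the universe lemma fails — those carriers go to the vacancy-keyed row).
WHAT THIS IS NOT: no cover theorem («every valid blocker assignment canonicalises into these lists» is certified by the two-lineage list diff,
19480-p1 ↔ cf-p2, not in kernel); F-C1 not moved.
-/

namespace Summit.Ventures.Crystal3D.Theorems

open Summit.Ventures.Crystal3D Finset NearIdentity

set_option maxRecDepth 200000 in
/-- **Facts, degree 8** (100 patterns): wf, own = four `√2`-blockers, `1`-separated, all slots occupied-or-blocked, `8` contacts. -/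
theorem exactPatterns8_facts : ∀ C ∈ exactPatterns8,
    C.wf = true ∧ C.contacts.length = 8 ∧ (∀ p ∈ C.own, sdot3 p p = 36) ∧
    (∀ p ∈ C.listed, ∀ p' ∈ C.listed, p ≠ p' → 18 ≤ sdot3 (p - p') (p - p')) ∧
    (∀ i : Fin 12, 3 • slotInt i ∈ C.contacts ∨ ∃ p ∈ C.own, sdot3 (p - 3 • slotInt i) (p - 3 • slotInt i) < 18) := by
  decide +kernel

set_option maxRecDepth 200000 in
/-- **Facts, degree 9** (246 patterns): wf, own norms `∈ {18, 36}` with at most one twin contact, `1`-separated, all slots occupied-or-blocked,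
`#contacts + #twin contacts = 9`. -/
theorem exactPatterns9_facts : ∀ C ∈ exactPatterns9,
    C.wf = true ∧ (∀ p ∈ C.own, sdot3 p p = 18 ∨ sdot3 p p = 36) ∧ (C.own.filter fun p => sdot3 p p = 18).length ≤ 1 ∧
    C.contacts.length + (C.own.filter fun p => sdot3 p p = 18).length = 9 ∧
    (∀ p ∈ C.listed, ∀ p' ∈ C.listed, p ≠ p' → 18 ≤ sdot3 (p - p') (p - p')) ∧
    (∀ i : Fin 12, 3 • slotInt i ∈ C.contacts ∨ ∃ p ∈ C.own, sdot3 (p - 3 • slotInt i) (p - 3 • slotInt i) < 18) := by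
  decide +kernel

set_option maxRecDepth 200000 in
/-- **Facts, degree 10, non-residual** (39 patterns): as above with `#contacts + #twin contacts = 10`, at most one twin contact. -/
theorem exactPatterns10_facts : ∀ C ∈ exactPatterns10,
    C.wf = true ∧ (∀ p ∈ C.own, sdot3 p p = 18 ∨ sdot3 p p = 36) ∧ (C.own.filter fun p => sdot3 p p = 18).length ≤ 1 ∧
    C.contacts.length + (C.own.filter fun p => sdot3 p p = 18).length = 10 ∧
    (∀ p ∈ C.listed, ∀ p' ∈ C.listed, p ≠ p' → 18 ≤ sdot3 (p - p') (p - p')) ∧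
    (∀ i : Fin 12, 3 • slotInt i ∈ C.contacts ∨ ∃ p ∈ C.own, sdot3 (p - 3 • slotInt i) (p - 3 • slotInt i) < 18) := by
  decide +kernel

set_option maxRecDepth 200000 in
/-- **Facts, RESIDUAL** (102 patterns, «defective twin caps»): `8` contacts plus EXACTLY TWO twin contacts (`deg = k + 2 = 10`), `1`-separated,
all slots occupied-or-blocked. -/
theorem residualPatterns10_facts : ∀ C ∈ residualPatterns10,
    C.wf = true ∧ C.contacts.length = 8 ∧ (∀ p ∈ C.own, sdot3 p p = 18 ∨ sdot3 p p = 36) ∧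
    (C.own.filter fun p => sdot3 p p = 18).length = 2 ∧
    (∀ p ∈ C.listed, ∀ p' ∈ C.listed, p ≠ p' → 18 ≤ sdot3 (p - p') (p - p')) ∧
    (∀ i : Fin 12, 3 • slotInt i ∈ C.contacts ∨ ∃ p ∈ C.own, sdot3 (p - 3 • slotInt i) (p - 3 • slotInt i) < 18) := by
  decide +kernel

/-- The list sizes of record: `100 + 246 + 39 = 385` exact non-residual patterns and `102` residual ones. -/
theorem exactPatterns_lengths : exactPatterns8.length = 100 ∧ exactPatterns9.length = 246 ∧ exactPatterns10.length = 39 ∧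
    residualPatterns10.length = 102 := by
  decide +kernel

end Summit.Ventures.Crystal3D.Theorems
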